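import Mathlib.GroupTheory.PushoutI
import Mathlib.GroupTheory.QuotientGroup.Basic
import Mathlib.CategoryTheory.Category.Quiv
import Mathlib.CategoryTheory.SingleObj
import Literature.GroupTheory.CombinatorialGroupTheory.PushoutIBassSerreTree
import Literature.GroupTheory.CombinatorialGroupTheory.FreeGroupoidWords
import HarnessLib

/-!
# The quotient `N \ T` of the Bass–Serre tree of `∗_H G_i` by a normal subgroup `N`, and its
# labelling functor to `P` (data)

Topic `Literature/GroupTheory/CombinatorialGroupTheory`; DATA file (explicit `def`s, no `instance`
declarations, no notation), sequel of `PushoutIBassSerreTree.lean`, for the brick "finite amalgams are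
virtually free".  Let `P = Monoid.PushoutI φ` (`φ i : H →* G i`), `T` its Bass–Serre tree (Serre, *Trees*
I §4.1 Thm. 7: vertices the cosets `pH` and `p G_i`, one edge `pH — p G_i` for each `i`) and `N ⊴ P` a
NORMAL subgroup.  Since `N` is normal, `N \ T` is the star-shaped quotient graph with

* central vertices `P / N·H` (`CenterClass N`), arm vertices `P / N·G_i` (`ArmClass N i`), and one
  arrow `[pH] ⟶ [p G_i]` for each `i` (`QuotVertex`, `QuotArrow`, `armOf`); the quiver structure is the
  explicit `quotQuiver` (non-instance), used through the bundled quiver `quotQuiv N : Quiv` so that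
  Mathlib's `Quiv.str'` supplies the instance;
* a LABELLING of the arrows by elements of `P` (Serre I §3.3, proof of Thm. 4 / §5.1 "trees of
  representatives"): with representatives `r = c.out` of a central class and `a = d.out` of its arm class,
  `a⁻¹ r ∈ N·G_i` and the label of the arrow `(i, c)` is the `G_i`-part `label N i c` of `a⁻¹ r`
  modulo `N` (`armPart`, well defined up to the junk convention, characterised by `label_spec` when
  `N ∩ G_i = 1`);
* the induced functor `quotFunctor N : FreeGroupoid (N\T) ⥤ P` (universal property of Mathlib's
  `Quiver.FreeGroupoid`), its values `fval` on morphisms with the computation rules `fval_toPos`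
  (forward arrow ↦ label), `fval_toNeg` (backward arrow ↦ label⁻¹), `fval_nil`, `fval_cons`, and its
  restriction `loopHom N c₀ : π₁(N\T, c₀) →* P` to a vertex group;
* the `H`-defect `baseDefect N p` of `p ∈ P` (the `H`-part of `r[p]⁻¹ p ∈ N·H`), used to normalise path
  values.

The sequel `FiniteAmalgamVirtuallyFree.lean` proves that `loopHom` is an isomorphism onto `N` when `N`
meets every factor trivially (Serre I §3.3 Thm. 4: `N ≅ π₁(N\T)` is free).

## References
* J.-P. Serre, *Trees*, Springer (1980), Ch. I §1.2 Thm. 1, §3.3 Thm. 4, §4.1 Thm. 7, §5.1. [SerreTrees1980]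
-/

namespace Literature.GroupTheory.CombinatorialGroupTheory

universe u v w

namespace PushoutITree

open Monoid Monoid.PushoutI Function CategoryTheory
open scoped Pointwise

variable {ι : Type u} {G : ι → Type v} [∀ i, Group (G i)] {H : Type w} [Group H]
  {φ : ∀ i, H →* G i} (N : Subgroup (PushoutI φ))

/-! ### The quotient star quiver `N \ T` -/

/-- `N·H`: the elements of `P` mapping the central vertex `H` of `T` into its `N`-orbit.
[cite: SerreTrees1980, I §4.1 Thm. 7] -/
abbrev centerStab : Subgroup (PushoutI φ) := N ⊔ baseRange φ

/-- `N·G_i`: the elements of `P` mapping the arm vertex `G_i` of `T` into its `N`-orbit.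
[cite: SerreTrees1980, I §4.1 Thm. 7] -/
abbrev armStab (i : ι) : Subgroup (PushoutI φ) := N ⊔ ofRange φ i

/-- `N·H ≤ N·G_i`. [cite: SerreTrees1980, I §4.1 Thm. 7] -/
theorem centerStab_le_armStab (i : ι) : centerStab N ≤ armStab N i :=
  sup_le_sup_left (baseRange_le_ofRange φ i) N

/-- Central vertices of `N \ T`: `P / N·H` (the `N`-orbits of the vertices `pH`).
[cite: SerreTrees1980, I §4.1 Thm. 7] -/
abbrev CenterClass : Type (max u v w) := PushoutI φ ⧸ centerStab N

/-- Arm vertices of `N \ T` of index `i`: `P / N·G_i` (the `N`-orbits of the vertices `p G_i`).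
[cite: SerreTrees1980, I §4.1 Thm. 7] -/
abbrev ArmClass (i : ι) : Type (max u v w) := PushoutI φ ⧸ armStab N i

/-- The arm vertex of index `i` adjacent to a central vertex (`[pH] ↦ [p G_i]`).
[cite: SerreTrees1980, I §4.1 Thm. 7] -/
def armOf (i : ι) : CenterClass N → ArmClass N i :=
  Subgroup.quotientMapOfLE (centerStab_le_armStab N i)

/-- `armOf i [p] = [p]`. [cite: SerreTrees1980, I §4.1 Thm. 7] -/
@[simp] theorem armOf_mk (i : ι) (p : PushoutI φ) :
    armOf N i (QuotientGroup.mk p) = QuotientGroup.mk p := rfl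

/-- Vertices of the quotient star quiver `N \ T`. [cite: SerreTrees1980, I §4.1 Thm. 7] -/
inductive QuotVertex : Type (max u v w)
  /-- the `N`-orbit of a central vertex `pH` -/
  | center (c : CenterClass N)
  /-- the `N`-orbit of an arm vertex `p G_i` -/
  | arm (i : ι) (d : ArmClass N i)

/-- Arrows of `N \ T`: one arrow `(i, c) : center c ⟶ arm i (armOf i c)` for each index `i` and central
class `c` (the target is carried as a variable `d` with `armOf i c = d`, for smooth case analysis).
[cite: SerreTrees1980, I §4.1 Thm. 7] -/
inductive QuotArrow : QuotVertex N → QuotVertex N → Type (max u v w)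
  /-- the arrow `(i, [pH]) : [pH] ⟶ [p G_i]` -/
  | mk (i : ι) (c : CenterClass N) (d : ArmClass N i) (h : armOf N i c = d) :
      QuotArrow (QuotVertex.center c) (QuotVertex.arm i d)

/-- The quiver structure of `N \ T` (explicit, non-instance). [cite: SerreTrees1980, I §4.1 Thm. 7] -/
@[reducible] def quotQuiver : Quiver.{max u v w} (QuotVertex N) := ⟨QuotArrow N⟩

/-- `N \ T` as a bundled quiver: Mathlib's `Quiv.str'` then provides the quiver structure on
`↥(quotQuiv N) = QuotVertex N`, so no instance needs to be declared. [cite: SerreTrees1980, I §4.1 Thm. 7] -/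
def quotQuiv : Quiv.{max u v w, max u v w} := @Quiv.of (QuotVertex N) (quotQuiver N)

/-- A central vertex, as a vertex of the symmetrified quiver (where zigzag paths live).
[cite: SerreTrees1980, I §4.1 Thm. 7] -/
abbrev ctrS (c : CenterClass N) : Quiver.Symmetrify (quotQuiv N) := QuotVertex.center c

/-- An arm vertex, as a vertex of the symmetrified quiver. [cite: SerreTrees1980, I §4.1 Thm. 7] -/
abbrev armS (i : ι) (d : ArmClass N i) : Quiver.Symmetrify (quotQuiv N) := QuotVertex.arm i d

/-- The forward formal arrow `(i, c)⁺ : center c ⟶ arm i d` of the symmetrified quiver.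
[cite: SerreTrees1980, I §4.1 Thm. 7] -/
abbrev fwd (i : ι) (c : CenterClass N) (d : ArmClass N i) (h : armOf N i c = d) :
    (ctrS N c ⟶ armS N i d) :=
  Sum.inl (QuotArrow.mk i c d h)

/-- The backward formal arrow `(i, c)⁻ : arm i d ⟶ center c` of the symmetrified quiver.
[cite: SerreTrees1980, I §4.1 Thm. 7] -/
abbrev bwd (i : ι) (c : CenterClass N) (d : ArmClass N i) (h : armOf N i c = d) :
    (armS N i d ⟶ ctrS N c) :=
  Sum.inr (QuotArrow.mk i c d h)

/-- The index of an arm vertex (`none` for a central vertex). [cite: SerreTrees1980, I §4.1 Thm. 7] -/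
def armIdx : QuotVertex N → Option ι
  | QuotVertex.center _ => none
  | QuotVertex.arm i _ => some i

/-- The index of the vertex a non-empty zigzag path visits just before its end (`none` for the empty
path or if that vertex is central). [cite: SerreTrees1980, I §4.1 Thm. 7] -/
def lastIdx {X : Quiver.Symmetrify (quotQuiv N)} :
    ∀ {Y : Quiver.Symmetrify (quotQuiv N)}, Quiver.Path X Y → Option ι
  | _, Quiver.Path.nil => none
  | _, Quiver.Path.cons (b := Z) _ _ => armIdx N Z

/-- A representative in `P` of a vertex of `N \ T` ("tree of representatives", chosen by `out`).
[cite: SerreTrees1980, I §5.1] -/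
noncomputable def vertexRep : QuotVertex N → PushoutI φ
  | QuotVertex.center c => c.out
  | QuotVertex.arm _ d => d.out

/-! ### Decompositions modulo the normal subgroup `N` -/

variable {N}

/-- Membership in `N ⊔ K = N·K` for normal `N` (set form of `Subgroup.normal_mul`).
[cite: SerreTrees1980, I §3.3 Thm. 4] -/
theorem mem_sup_iff_of_normal [N.Normal] (K : Subgroup (PushoutI φ)) (x : PushoutI φ) :
    x ∈ N ⊔ K ↔ ∃ k ∈ K, x * k⁻¹ ∈ N := by
  rw [← SetLike.mem_coe, Subgroup.normal_mul, Set.mem_mul]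
  constructor
  · rintro ⟨n, hn, k, hk, rfl⟩
    exact ⟨k, hk, by simpa using hn⟩
  · rintro ⟨k, hk, h⟩
    exact ⟨x * k⁻¹, h, k, hk, by simp⟩

variable (N) in
/-- The `G_i`-part of an element of `N·G_i` modulo `N` (junk value outside `N·G_i`).
[cite: SerreTrees1980, I §3.3 Thm. 4] -/
noncomputable def armPart (i : ι) (x : PushoutI φ) : G i :=
  Classical.epsilon (fun g : G i => x * (of i g)⁻¹ ∈ N)

/-- `x ≡ of i (armPart i x)` modulo `N` for `x ∈ N·G_i`. [cite: SerreTrees1980, I §3.3 Thm. 4] -/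
theorem armPart_spec [N.Normal] {i : ι} {x : PushoutI φ} (hx : x ∈ armStab N i) :
    x * (of i (armPart N i x))⁻¹ ∈ N := by
  obtain ⟨k, ⟨g, rfl⟩, h⟩ := (mem_sup_iff_of_normal (ofRange φ i) x).mp hx
  exact Classical.epsilon_spec (p := fun g : G i => x * (of i g)⁻¹ ∈ N) ⟨g, h⟩

/-- Uniqueness of the `G_i`-part modulo `N` when `N ∩ G_i = 1`. [cite: SerreTrees1980, I §3.3 Thm. 4] -/
theorem eq_of_mul_inv_of_mem (hN : ∀ (i : ι) (g : G i), (of i g : PushoutI φ) ∈ N → g = 1)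
    {i : ι} {x : PushoutI φ} {g g' : G i}
    (hg : x * (of i g)⁻¹ ∈ N) (hg' : x * (of i g')⁻¹ ∈ N) : g = g' := by
  have hmem : (x * (of i g')⁻¹)⁻¹ * (x * (of i g)⁻¹) ∈ N := N.mul_mem (N.inv_mem hg') hg
  have hcalc : (x * (of i g')⁻¹)⁻¹ * (x * (of i g)⁻¹) = of i (g' * g⁻¹) := by
    rw [map_mul, map_inv]; group
  rw [hcalc] at hmem
  have := hN i _ hmem
  rw [mul_inv_eq_one] at this
  exact this.symm

variable (N) in
/-- The `H`-part of an element of `N·H` modulo `N` (junk value outside `N·H`).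
[cite: SerreTrees1980, I §3.3 Thm. 4] -/
noncomputable def basePart (x : PushoutI φ) : H :=
  Classical.epsilon (fun h : H => x * (PushoutI.base φ h)⁻¹ ∈ N)

/-- `x ≡ base (basePart x)` modulo `N` for `x ∈ N·H`. [cite: SerreTrees1980, I §3.3 Thm. 4] -/
theorem basePart_spec [N.Normal] {x : PushoutI φ} (hx : x ∈ centerStab N) :
    x * (PushoutI.base φ (basePart N x))⁻¹ ∈ N := by
  obtain ⟨k, ⟨h, rfl⟩, hk⟩ := (mem_sup_iff_of_normal (baseRange φ) x).mp hx
  exact Classical.epsilon_spec (p := fun h : H => x * (PushoutI.base φ h)⁻¹ ∈ N) ⟨h, hk⟩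

/-- `N ∩ G_i = 1` for all `i` implies `N ∩ H = 1` (some factor exists, `φ` injective).
[cite: SerreTrees1980, I §3.3 Thm. 4] -/
theorem base_mem_imp [Nonempty ι] (hφ : ∀ i, Injective (φ i))
    (hN : ∀ (i : ι) (g : G i), (of i g : PushoutI φ) ∈ N → g = 1) (h : H)
    (hh : PushoutI.base φ h ∈ N) : h = 1 := by
  obtain ⟨i⟩ := ‹Nonempty ι›
  have := hN i (φ i h) (by rwa [of_apply_eq_base])
  exact hφ i (by rw [this, map_one])

/-- Uniqueness of the `H`-part modulo `N`. [cite: SerreTrees1980, I §3.3 Thm. 4] -/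
theorem eq_of_mul_inv_base_mem [Nonempty ι] (hφ : ∀ i, Injective (φ i))
    (hN : ∀ (i : ι) (g : G i), (of i g : PushoutI φ) ∈ N → g = 1)
    {x : PushoutI φ} {h h' : H}
    (hh : x * (PushoutI.base φ h)⁻¹ ∈ N) (hh' : x * (PushoutI.base φ h')⁻¹ ∈ N) : h = h' := by
  have hmem : (x * (PushoutI.base φ h')⁻¹)⁻¹ * (x * (PushoutI.base φ h)⁻¹) ∈ N :=
    N.mul_mem (N.inv_mem hh') hh
  have hcalc : (x * (PushoutI.base φ h')⁻¹)⁻¹ * (x * (PushoutI.base φ h)⁻¹) =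
      PushoutI.base φ (h' * h⁻¹) := by
    rw [map_mul, map_inv]; group
  rw [hcalc] at hmem
  have := base_mem_imp hφ hN _ hmem
  rw [mul_inv_eq_one] at this
  exact this.symm

/-! ### Labels of the arrows -/

/-- `a⁻¹ r ∈ N·G_i` for the representatives `r` of a central class and `a` of its `i`-th arm class.
[cite: SerreTrees1980, I §5.1] -/
theorem out_inv_mul_out_mem (i : ι) (c : CenterClass N) :
    ((armOf N i c).out)⁻¹ * c.out ∈ armStab N i := by
  rw [← QuotientGroup.eq, QuotientGroup.out_eq']
  conv_lhs => rw [← QuotientGroup.out_eq' c]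
  rfl

variable (N) in
/-- The label of the arrow `(i, c)`: the `G_i`-part modulo `N` of `a⁻¹ r`, `r = c.out`,
`a = (armOf i c).out`. [cite: SerreTrees1980, I §3.3 Thm. 4] -/
noncomputable def label (i : ι) (c : CenterClass N) : G i :=
  armPart N i (((armOf N i c).out)⁻¹ * c.out)

/-- Defining congruence of the label: `a⁻¹ r ≡ of i (label i c)` modulo `N`.
[cite: SerreTrees1980, I §3.3 Thm. 4] -/
theorem label_spec [N.Normal] (i : ι) (c : CenterClass N) :
    ((armOf N i c).out)⁻¹ * c.out * (of i (label N i c))⁻¹ ∈ N :=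
  armPart_spec (out_inv_mul_out_mem i c)

variable (N) in
/-- The `H`-defect of `p ∈ P`: the `H`-part modulo `N` of `r[p]⁻¹ p ∈ N·H`, `r[p] = (mk p).out` the
representative of the central class of `p`. [cite: SerreTrees1980, I §3.3 Thm. 4] -/
noncomputable def baseDefect (p : PushoutI φ) : H :=
  basePart N (((QuotientGroup.mk p : CenterClass N).out)⁻¹ * p)

/-- `r[p]⁻¹ p ∈ N·H`. [cite: SerreTrees1980, I §5.1] -/
theorem out_inv_mul_mem (p : PushoutI φ) :
    ((QuotientGroup.mk p : CenterClass N).out)⁻¹ * p ∈ centerStab N := by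
  rw [← QuotientGroup.eq, QuotientGroup.out_eq']

/-- Defining congruence of the defect: `r[p]⁻¹ p ≡ base (baseDefect p)` modulo `N`.
[cite: SerreTrees1980, I §3.3 Thm. 4] -/
theorem baseDefect_spec [N.Normal] (p : PushoutI φ) :
    ((QuotientGroup.mk p : CenterClass N).out)⁻¹ * p * (PushoutI.base φ (baseDefect N p))⁻¹ ∈ N :=
  basePart_spec (out_inv_mul_mem p)

/-! ### The labelling functor `F : FreeGroupoid (N \ T) ⥤ P` -/

variable (N) in
/-- The label of an arrow of `N \ T` as an element of `P`. [cite: SerreTrees1980, I §3.3 Thm. 4] -/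
noncomputable def QuotArrow.label : ∀ {X Y : QuotVertex N}, QuotArrow N X Y → PushoutI φ
  | _, _, QuotArrow.mk i c _ _ => of i (PushoutITree.label N i c)

variable (N) in
/-- The labelling prefunctor `N \ T ⥤q P` (to the one-object quiver of `P`).
[cite: SerreTrees1980, I §3.3 Thm. 4] -/
noncomputable def labelling : quotQuiv N ⥤q SingleObj (PushoutI φ) where
  obj _ := SingleObj.star _
  map f := QuotArrow.label N f

variable (N) in
/-- The labelling functor `F : FreeGroupoid (N \ T) ⥤ P` (universal property of the free groupoid).
[cite: SerreTrees1980, I §3.3 Thm. 4] -/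
noncomputable def quotFunctor : Quiver.FreeGroupoid (quotQuiv N) ⥤ SingleObj (PushoutI φ) :=
  Quiver.FreeGroupoid.lift (labelling N)

open FreeGroupoidWords

variable (N) in
/-- The value in `P` of a morphism of the free groupoid on `N \ T` under the labelling functor (the
hom-types of `SingleObj P` are `P`; this fixes the type for elaboration). [cite: SerreTrees1980, I §3.3 Thm. 4] -/
noncomputable def fval {a b : Quiver.FreeGroupoid (quotQuiv N)} (x : a ⟶ b) : PushoutI φ :=
  (quotFunctor N).map x

/-- `F (x ≫ y) = F y · F x`. [cite: SerreTrees1980, I §3.3 Thm. 4] -/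
theorem fval_comp {a b c : Quiver.FreeGroupoid (quotQuiv N)} (x : a ⟶ b) (y : b ⟶ c) :
    fval N (x ≫ y) = fval N y * fval N x := by
  unfold fval
  rw [CategoryTheory.Functor.map_comp, SingleObj.comp_as_mul]

/-- `F (𝟙) = 1`. [cite: SerreTrees1980, I §3.3 Thm. 4] -/
theorem fval_id (a : Quiver.FreeGroupoid (quotQuiv N)) : fval N (𝟙 a) = 1 := by
  unfold fval
  rw [CategoryTheory.Functor.map_id, SingleObj.id_as_one]

/-- A forward arrow is mapped to its label. [cite: SerreTrees1980, I §3.3 Thm. 4] -/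
theorem fval_toPos {X Y : quotQuiv N} (e : X ⟶ Y) :
    fval N (homMk e.toPos.toPath) = QuotArrow.label N e := by
  change (Paths.lift (Quiver.Symmetrify.lift (labelling N))).map e.toPos.toPath = _
  rw [Paths.lift_toPath]
  rfl

/-- A backward arrow is mapped to the inverse of its label. [cite: SerreTrees1980, I §3.3 Thm. 4] -/
theorem fval_toNeg {X Y : quotQuiv N} (e : X ⟶ Y) :
    fval N (homMk e.toNeg.toPath) = (QuotArrow.label N e)⁻¹ := by
  change (Paths.lift (Quiver.Symmetrify.lift (labelling N))).map e.toNeg.toPath = _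
  rw [Paths.lift_toPath]
  rfl

/-- The empty path is mapped to `1`. [cite: SerreTrees1980, I §3.3 Thm. 4] -/
theorem fval_nil (X : Quiver.Symmetrify (quotQuiv N)) :
    fval N (homMk (Quiver.Path.nil : Quiver.Path X X)) = 1 := by
  rw [homMk_nil, fval_id]

/-- Extending a path multiplies the value ON THE LEFT by the value of the new arrow.
[cite: SerreTrees1980, I §3.3 Thm. 4] -/
theorem fval_cons {X Y Z : Quiver.Symmetrify (quotQuiv N)} (p : Quiver.Path X Y) (f : Y ⟶ Z) :
    fval N (homMk (p.cons f)) = fval N (homMk f.toPath) * fval N (homMk p) := by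
  rw [homMk_cons, fval_comp]

variable (N) in
/-- The labelling functor on the vertex group `π₁(N \ T, c₀)` of the free groupoid at a central vertex,
as a group homomorphism to `P`. [cite: SerreTrees1980, I §3.3 Thm. 4] -/
noncomputable def loopHom (c₀ : CenterClass N) : End (obj (ctrS N c₀)) →* PushoutI φ where
  toFun x := fval N x
  map_one' := fval_id _
  map_mul' x y := fval_comp y x

/-- `loopHom` is `fval`. [cite: SerreTrees1980, I §3.3 Thm. 4] -/
@[simp] theorem loopHom_apply (c₀ : CenterClass N) (x : End (obj (ctrS N c₀))) :
    loopHom N c₀ x = fval N x := rfl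

end PushoutITree

end Literature.GroupTheory.CombinatorialGroupTheory
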